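import Mathlib
import HarnessLib
import Summits.HubbardSuperconductivity.HubbardSuperconductivity.Theorems.KLProgrammeKLRegimeEngineV8DefsQ9c
import Summits.HubbardSuperconductivity.HubbardSuperconductivity.Theorems.KLProgrammeKLRegimeEnginePairTransferDLineRoomReading

/-!
# Route `KLProgramme` — ENGINE item stmt-HubbardSuperconductivity-20437 `KLRegimeEngineV17F2`, stub (c) value lane, «(c)-OUT»: THE LATTICE TERM OF THE FORWARD-WINDOW ROWS
# IS β²-FLAT AND BOOKS INTO `Q.CL β n / L` BY NAME (cell gate-hubbard-kl, seat hubbard-kl-k3c2-p2 g18; recipe HOME/hubbard-kl-k3c2-p2/OUT-OF-CLASS-E2.md §6)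

The capstone `outClass_sameFrame_le_slots` (…PairTransferOutClassSameFrame) carries the lattice (finite-`L` Riemann-sum) residue of the two signed forward-window
rows as `4·LAT₀/L` with
`LAT₀ = 96·(512·L_A/Λₙ₊₁ + 32·A₀·G·c_j/Λₙ₊₁²)`, `c_j = (9·(2·(448/3)e² + 8) + 32) + (65·8·16^{j−(n+1)} + 17408/3)`,
`(A₀, L_A)` the dressed-moment kernel data, `G` the band constant.  In the multiscale regime `n ≤ n_β` (`π/(4β) ≤ Λₙ₊₁`,
`pi_div_four_mul_le_klScale_of_le_nScales_succ`) this is **β²-flat**: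
* `latticeTerm_le_of_regime` — `4·LAT₀ ≤ (β²+1)·(2¹⁸·L_A + 2³⁰·A₀·G·16^{j−(n+1)})`;
* `latticeTerm_div_le_CL_share` — hence, for any share `s ≥ 0` with `2¹⁸L_A + 2³⁰A₀G·16^{j−(n+1)} ≤ s·2⁶⁰·Psq²·Rsq²·4ⁿ`,
  `4·LAT₀/L ≤ s·(klEngQ9c P R).CL β n / L` — the `Q.CL β n/L` term of `eremBar klEngGeo11 P (klEngQ9c P R) U β L n` (the erem slot of (E2″-F) sits at the LOWER scale `n`
  of the step `n → n+1`); `(klEngQ9c P R).CL β n = 2⁶⁰·klEngPsq P²·klEngRsq R²·(β²+1)·4ⁿ` (`rfl`);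
* `latticeTerm_div_le_CL_share_of_sizes` — the same at the plain member index `j = n+1` from the two SIZE DEMANDS on the dressed moments
  `L_A ≤ 2⁴⁰·s·Psq²Rsq²`, `A₀·G ≤ 2²⁸·s·Psq²Rsq²` («(E4)-DRESSED-MOMENTS», by name).
Pure arithmetic (`3.14 < π`, `e < 2.7182818286`); nothing about the model is asserted; nothing asserts (E2″-F), (c), K3 or superconductivity.  0 kit · 0 lit.
-/

noncomputable section

namespace Summit.HubbardSuperconductivity.HubbardSuperconductivity.Theorems.KLRegimeSplit

set_option linter.dupNamespace false -- summit = problem name (single-conjunct summit), D-0017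

open Real Finset Set Literature.MathematicalPhysics.QuantumLattice Literature.Probability.LatticeModels
open Literature.MathematicalPhysics.QuantumLattice.FermiRG
open Summit.HubbardSuperconductivity.HubbardSuperconductivity.Theorems.KLProgrammeLegKernels
open Summit.HubbardSuperconductivity.HubbardSuperconductivity.Theorems.TwoPointAssembly
open Summit.HubbardSuperconductivity.HubbardSuperconductivity.Theorems.DispersionFlow
open Summit.HubbardSuperconductivity.HubbardSuperconductivity.Theorems.KLRegimeWick
open Summit.HubbardSuperconductivity.HubbardSuperconductivity.Theorems.EngineV8

/-- `e² ≤ 7.3891`. -/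
theorem exp_two_le_d4 : Real.exp 2 ≤ 7.3891 := by
  have h1 := Real.exp_one_lt_d9
  have he : Real.exp 2 = Real.exp 1 ^ 2 := by
    rw [← Real.exp_nat_mul]; norm_num
  rw [he]
  nlinarith [Real.exp_pos 1, h1]

/-- The constant `c_j` of the lattice term: `c_j ≤ 26289·16^{j−(n+1)}`. -/
theorem latticeConst_le (j n : ℕ) :
    ((9 * (2 * (448 / 3 * Real.exp 2) + 8) + 4 * 8) + (65 * (8 * (16 : ℝ) ^ (j - (n + 1))) + 17408 / 3 * 1)) ≤
      26289 * (16 : ℝ) ^ (j - (n + 1)) := by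
  have he := exp_two_le_d4
  have h16 : (1 : ℝ) ≤ (16 : ℝ) ^ (j - (n + 1)) := one_le_pow₀ (by norm_num)
  nlinarith [he, h16, Real.exp_pos 2]

/-- `0 ≤ c_j`. -/
theorem latticeConst_nonneg (j n : ℕ) :
    0 ≤ ((9 * (2 * (448 / 3 * Real.exp 2) + 8) + 4 * 8) + (65 * (8 * (16 : ℝ) ^ (j - (n + 1))) + 17408 / 3 * 1)) := by
  have := Real.exp_pos 2
  positivity

/-- **The lattice term is β²-flat in the regime**: for `klBetaMin ≤ β`, `n ≤ n_β`, `A₀, L_A, G ≥ 0`,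
`4·LAT₀ ≤ (β²+1)·(2¹⁸·L_A + 2³⁰·A₀·G·16^{j−(n+1)})`. -/
theorem latticeTerm_le_of_regime {β : ℝ} (hβ : klBetaMin ≤ β) {n : ℕ} (hn : n ≤ nScales β) (j : ℕ) {A₀ LA G : ℝ}
    (hA0 : 0 ≤ A₀) (hLA : 0 ≤ LA) (hG : 0 ≤ G) :
    4 * (96 * (512 * LA / klScale klE0 (n + 1) +
        32 * A₀ * G * ((9 * (2 * (448 / 3 * Real.exp 2) + 8) + 4 * 8) + (65 * (8 * (16 : ℝ) ^ (j - (n + 1))) + 17408 / 3 * 1)) /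
          klScale klE0 (n + 1) ^ 2)) ≤
      (β ^ 2 + 1) * (2 ^ 18 * LA + 2 ^ 30 * A₀ * G * (16 : ℝ) ^ (j - (n + 1))) := by
  have hβ0 : 0 < β := pos_of_klBetaMin_le hβ
  have hΛ : π / (4 * β) ≤ klScale klE0 (n + 1) := pi_div_four_mul_le_klScale_of_le_nScales_succ hβ (show n + 1 ≤ nScales β + 1 by omega)
  have hΛ0 : 0 < klScale klE0 (n + 1) := klth_klScale_pos _
  have hπ : 3.14 < π := Real.pi_gt_d2
  -- `1/Λₙ₊₁ ≤ 4β/π ≤ 1.28·β`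
  have hinv : 1 / klScale klE0 (n + 1) ≤ 1.28 * β := by
    have h := one_div_le_one_div_of_le (by positivity : 0 < π / (4 * β)) hΛ
    rw [one_div_div] at h
    refine h.trans ?_
    rw [div_le_iff₀ Real.pi_pos]
    nlinarith [hπ, hβ0]
  have hinv0 : 0 ≤ 1 / klScale klE0 (n + 1) := by positivity
  have hinv2 : 1 / klScale klE0 (n + 1) ^ 2 ≤ (1.28 * β) ^ 2 := by
    rw [← one_div_pow]
    exact pow_le_pow_left₀ hinv0 hinv 2
  set cj : ℝ := ((9 * (2 * (448 / 3 * Real.exp 2) + 8) + 4 * 8) + (65 * (8 * (16 : ℝ) ^ (j - (n + 1))) + 17408 / 3 * 1)) with hcj_def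
  have hcj : cj ≤ 26289 * (16 : ℝ) ^ (j - (n + 1)) := latticeConst_le j n
  have hcj0 : 0 ≤ cj := latticeConst_nonneg j n
  have h16 : (0 : ℝ) ≤ (16 : ℝ) ^ (j - (n + 1)) := by positivity
  -- term 1
  have t1 : 512 * LA / klScale klE0 (n + 1) ≤ 512 * LA * (1.28 * β) := by
    rw [div_eq_mul_one_div]
    exact mul_le_mul_of_nonneg_left hinv (by positivity)
  -- term 2
  have t2 : 32 * A₀ * G * cj / klScale klE0 (n + 1) ^ 2 ≤ 32 * A₀ * G * (26289 * (16 : ℝ) ^ (j - (n + 1))) * (1.28 * β) ^ 2 := by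
    rw [div_eq_mul_one_div]
    exact mul_le_mul (mul_le_mul_of_nonneg_left hcj (by positivity)) hinv2 (by positivity) (by positivity)
  -- `β ≤ β²+1`, `β² ≤ β²+1`
  have hβ1 : β ≤ β ^ 2 + 1 := by nlinarith [sq_nonneg (β - 1 / 2)]
  have hLAβ : LA * β ≤ LA * (β ^ 2 + 1) := mul_le_mul_of_nonneg_left hβ1 hLA
  have hY : A₀ * G * (16 : ℝ) ^ (j - (n + 1)) * β ^ 2 ≤ A₀ * G * (16 : ℝ) ^ (j - (n + 1)) * (β ^ 2 + 1) :=
    mul_le_mul_of_nonneg_left (by linarith) (by positivity)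
  nlinarith [t1, t2, hLAβ, hY, mul_nonneg hLA hβ0.le, mul_nonneg (mul_nonneg (mul_nonneg hA0 hG) h16) (sq_nonneg β)]

/-- **Booking the lattice term into `Q.CL β n / L`**: with a share `s` such that
`2¹⁸·L_A + 2³⁰·A₀·G·16^{j−(n+1)} ≤ s·(2⁶⁰·Psq²·Rsq²·4ⁿ)`, `4·LAT₀/L ≤ s·((klEngQ9c P R).CL β n / L)`. -/
theorem latticeTerm_div_le_CL_share (P : SplitConsts) (R : RenConsts) {β : ℝ} (hβ : klBetaMin ≤ β) {n : ℕ} (hn : n ≤ nScales β)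
    (j L : ℕ) {A₀ LA G s : ℝ} (hA0 : 0 ≤ A₀) (hLA : 0 ≤ LA) (hG : 0 ≤ G)
    (hfit : 2 ^ 18 * LA + 2 ^ 30 * A₀ * G * (16 : ℝ) ^ (j - (n + 1)) ≤ s * (2 ^ 60 * klEngPsq P ^ 2 * klEngRsq R ^ 2 * (4 : ℝ) ^ n)) :
    4 * (96 * (512 * LA / klScale klE0 (n + 1) +
        32 * A₀ * G * ((9 * (2 * (448 / 3 * Real.exp 2) + 8) + 4 * 8) + (65 * (8 * (16 : ℝ) ^ (j - (n + 1))) + 17408 / 3 * 1)) /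
          klScale klE0 (n + 1) ^ 2) / L) ≤
      s * ((klEngQ9c P R).CL β n / L) := by
  have h := latticeTerm_le_of_regime hβ hn j hA0 hLA hG
  have hCL : (klEngQ9c P R).CL β n = 2 ^ 60 * klEngPsq P ^ 2 * klEngRsq R ^ 2 * (β ^ 2 + 1) * (4 : ℝ) ^ n := rfl
  have hb1 : 0 ≤ β ^ 2 + 1 := by positivity
  have hfit' : (β ^ 2 + 1) * (2 ^ 18 * LA + 2 ^ 30 * A₀ * G * (16 : ℝ) ^ (j - (n + 1))) ≤ s * (klEngQ9c P R).CL β n := by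
    rw [hCL]
    have := mul_le_mul_of_nonneg_left hfit hb1
    linarith [this, show (β ^ 2 + 1) * (s * (2 ^ 60 * klEngPsq P ^ 2 * klEngRsq R ^ 2 * (4 : ℝ) ^ n)) =
      s * (2 ^ 60 * klEngPsq P ^ 2 * klEngRsq R ^ 2 * (β ^ 2 + 1) * (4 : ℝ) ^ n) by ring]
  have hL : (0 : ℝ) ≤ L := Nat.cast_nonneg L
  rw [mul_div_assoc', mul_div_assoc']
  exact div_le_div_of_nonneg_right (h.trans hfit') hL

/-- **The same from the two SIZE DEMANDS at the plain member index `j = n+1`**: `L_A ≤ 2⁴⁰·s·Psq²Rsq²` and `A₀·G ≤ 2²⁸·s·Psq²Rsq²` give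
`4·LAT₀/L ≤ s·((klEngQ9c P R).CL β n / L)` at every `n ≤ n_β`. -/
theorem latticeTerm_div_le_CL_share_of_sizes (P : SplitConsts) (R : RenConsts) {β : ℝ} (hβ : klBetaMin ≤ β) {n : ℕ} (hn : n ≤ nScales β)
    (L : ℕ) {A₀ LA G s : ℝ} (hA0 : 0 ≤ A₀) (hLA : 0 ≤ LA) (hG : 0 ≤ G) (hs : 0 ≤ s)
    (hLAs : LA ≤ 2 ^ 40 * s * (klEngPsq P ^ 2 * klEngRsq R ^ 2)) (hA0s : A₀ * G ≤ 2 ^ 28 * s * (klEngPsq P ^ 2 * klEngRsq R ^ 2)) :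
    4 * (96 * (512 * LA / klScale klE0 (n + 1) +
        32 * A₀ * G * ((9 * (2 * (448 / 3 * Real.exp 2) + 8) + 4 * 8) + (65 * (8 * (16 : ℝ) ^ (n + 1 - (n + 1))) + 17408 / 3 * 1)) /
          klScale klE0 (n + 1) ^ 2) / L) ≤
      s * ((klEngQ9c P R).CL β n / L) := by
  refine latticeTerm_div_le_CL_share P R hβ hn (n + 1) L hA0 hLA hG ?_
  rw [Nat.sub_self, pow_zero, mul_one]
  have hPR : 0 ≤ klEngPsq P ^ 2 * klEngRsq R ^ 2 := by positivity
  have h4 : (1 : ℝ) ≤ (4 : ℝ) ^ n := one_le_pow₀ (by norm_num)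
  have hsPR : 0 ≤ s * (klEngPsq P ^ 2 * klEngRsq R ^ 2) := mul_nonneg hs hPR
  nlinarith [hLAs, hA0s, h4, hsPR]

end Summit.HubbardSuperconductivity.HubbardSuperconductivity.Theorems.KLRegimeSplit

end
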